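import Mathlib
import Summits.HodgeConjecture.FermatCycles.HodgeFermatRowUZ1Eleven

/-!
# The row (Z3, Z1) of THEOREM L at `p = 5` for squarefree levels divisible by 3 (`HodgeFermat/FiveZ3Z1.lean`; HF-G30)

Tree copy (whole module) of the module `HodgeFermat/FiveZ3Z1.lean` of the sibling cell's standalone package
`run/shared/lean/pub/pub-hodgefermat/lean/HodgeFermat/` (118 lines, sha256 `c5663be41053f691…`), source lines 37–118 (all: `sameType_scale`, `z3z1_five`, `z3z1_five′`).
Filed by cell `pub-hfermat`, seat prover-1 gen-3, on the COORDINATOR KEEPER RULING of 2026-08-25 (gem sweep H1: take the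
off-gate kernel theorem `thmFstar` through the gate) — here THEOREM F* of `tables/DPRIME-THEOREM.md` §9 IN FULL, i.e.
PROPOSITION D′(3N) and the descent (`HodgeFermat/PropDPrimeNFinal.lean`, GATE HF-G34), the last off-gate form of THEOREM F*
(its first two forms, `DecodingFinal.thmFstar` = F* at the prime levels and `ThmFstarNFinal.thmFstar` = F*(3N), landed on
2026-08-25 as `HodgeFermatThmFstar.lean` / `HodgeFermatThmFstarN.lean`, seats prover-1 gen-0 / gen-2); this file is one link of
the import closure of `PropDPrimeNFinal.propDprime` (the sibling's KR-free chain: THEOREM L, COROLLARY M, THEOREM D6,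
THEOREM U⁺, THEOREM KR6, THEOREM Z3U) on top of those landed chains.  The source module is the sibling's hub-checked module of
record (pub-hodgefermat `CERT.md` l.957, GATE HF-G30; cell record `check/FiveZ3Z1_standalone.lean` sha256 `6778e00dbf961236…`); its declarations are copied VERBATIM.
Deviations from the source module, exhaustively: the `import` lines (tree modules `Summits.HodgeConjecture.FermatCycles.
HodgeFermat*` instead of `HodgeFermat.*`); this module docstring; the source's `open HodgeFermat.KRFree.Descent (descent sameType_symm')` (l.42) becomes `open HodgeFermat.KRFree.Descent (descent)` followed by `open HodgeFermat.KRFree.Decoding renaming st_symm → sameType_symm'` (the restated `sameType_symm'` was deleted in `HodgeFermatDescent.lean`).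
Every other line — in particular every declaration's statement and proof — is byte-identical to the source.
HONEST FRAMING: explicit algebraic cycles for specific Hodge classes on Fermat/Delsarte varieties; residual open instances
listed; no claim on general Hodge.  (This file is arithmetic of CM types / finite combinatorics / analytic number theory
of the sibling's KR-free programme; it claims nothing about cycles.)

The source module's docstring (FiveZ3Z1.lean l.3–35), verbatim:

## HodgeFermat/FiveZ3Z1.lean — generation 30 (HF-G30) of the hodge-fermat build

THEOREM L (`tables/DPRIME-THEOREM.md` §3), ROW p = 5, SHARPENED AT SQUAREFREE LEVELS: THE PATTERN (Z3, Z1) AT 5 IS EMPTY.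
Let `m = 5n` with `n` squarefree, odd, `5 ∤ n`.  The hand proof of THEOREM L (generation 20) and its kernel form
`TheoremL.row_Z3Z1_five` (generation 21) leave, at `p = 5`, the alternative "(Z3, Z1) with the 5-divisible entry
`x₁′ = 5y ≡ ± m/3 (mod m)`" (so `3 ∣ n`, `n = 3·gcd(y, n)`); `RowsFinal.five_pattern` / `CorollaryMRows.five_clause`
(generation 29) carry it as their second disjunct.  THIS MODULE CLOSES IT: at squarefree odd levels the alternative is
VACUOUS —

* `z3z1_five` — a zero-sum triple `T′ = (5y, x₂, x₃)` of level `5n`, Z1 at 5 (`5 ∤ x₂`, `5 ∤ x₃`) with `n ∤ y`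
  (i.e. `5y ≢ 0 (mod 5n)`), NEVER has the CM type (`LemmaN.SameType (5 * n)`) of a triple `(5a, 5b, 5c)` all of whose
  entries are divisible by 5 — for ARBITRARY `a, b, c` (no zero sum, no non-vanishing, no primitivity asked of it);
* `z3z1_five'` — the same with the Z3 triple written first (the orientation of `TheoremL.row_Z3Z1_five`).

Consequently (module `FiveFinal.lean`) THEOREM L's row p = 5 reads, at squarefree odd levels, "neither triple is Z3 at 5:
the pattern at 5 is (U, U), (U, Z1) or (Z1, Z1)" and COROLLARY M's clause at 5 loses its exceptional case.

PROOF ("pointwise at 5, scale, descend" — every ingredient is a kernel theorem of generations 21–29):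
1. `TheoremL.row_Z3Z1_five` (LEMMA N (Z1) against the Z3 fibre count, gen 21): `n = 3g`, `g = gcd(y, n)`; write
   `ȳ = y mod n = g·w`, `w ∈ {1, 2}` (`TheoremL.val_cases`, LEMMA O).
2. `RowUZ1Eleven.pointwise₅` + `inH_const` (gen 29, HF-G29c): for every unit `t₀` of `ℤ/n`,
   `t₀ ∈ H_{(a, b, c)} ⟺ ⟨t₀ y⟩_n = g ⟺ t₀ ∈ H_V`, `V = (ȳ, ȳ, ȳ) = (n/3)(w, w, w)`: `SameType n (a, b, c) V`.
3. SCALING (`sameType_scale`, new, elementary: `t·(5x) mod 5n = 5·(tx mod n)`): `SameType (5n) (5a, 5b, 5c) (5V)` with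
   `5V = (5n/3)(w, w, w)`; composing with the hypothesis, `T′` has the CM type of the CONSTANT triple `(5n/3)(w, w, w)`.
4. DESCENT LEMMA `Descent.descent` (gen 29, HF-G29b) at the squarefree odd level `5n` (3 ∣ 5n; `T′` has zero sum and no
   entry ≡ 0): every entry of `T′` is `≡ (5n/3)·w (mod 5n)`, in particular `5 ∣ x₂` — contradicting Z1.
Squarefreeness of `n` enters ONLY through the Descent Lemma (step 4); steps 1–3 hold for every odd `n` with `5 ∤ n`.

LIGHT module: imports `RowUZ1Eleven` only (cone: LemmaN, LemmaO, TheoremLRows, TheoremL13, TheoremUEq, TheoremZ3U, CoincEnum,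
CoincFull, Descent, RowUZ1Eleven).  No `sorry`, no new `decide` (the cone contains the `decide +kernel` certificates of
`CoincFull` / `RowUZ1Eleven`, not used here), no axiom beyond [propext, Classical.choice, Quot.sound].
-/

set_option autoImplicit false

namespace HodgeFermat.KRFree.FiveZ3Z1

open HodgeFermat.KRFree.LemmaN HodgeFermat.KRFree.TheoremL
open HodgeFermat.KRFree.Descent (descent)
open HodgeFermat.KRFree.Decoding renaming st_symm → sameType_symm'
open HodgeFermat.KRFree.RowUZ1Eleven (pointwise₅ inH_const)

/-! ## 1. Scaling the level -/

/-- multiplying both triples and the level by a common factor `G > 0` preserves "same CM type" (the converse direction of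
`Descent.sameType_descend`; all that is used is `t·(Gx) mod Gn = G·(tx mod n)`, and a unit of `ℤ/Gn` is a unit of `ℤ/n`) -/
lemma sameType_scale {G n₁ a b c a' b' c' : ℕ} (hG : 0 < G) (h : SameType n₁ (a, b, c) (a', b', c')) :
    SameType (G * n₁) (G * a, G * b, G * c) (G * a', G * b', G * c') := by
  intro t ht
  have h1 := h t (Nat.Coprime.coprime_dvd_right (dvd_mul_left n₁ G) ht)
  have e : ∀ x, t * (G * x) % (G * n₁) = G * (t * x % n₁) := by
    intro x
    rw [show t * (G * x) = G * (t * x) by ring, Nat.mul_mod_mul_left]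
  have k2 : ∀ p q : ℕ, G * p + G * q < G * n₁ ↔ p + q < n₁ := by
    intro p q
    rw [← mul_add]
    exact ⟨Nat.lt_of_mul_lt_mul_left, fun hh => Nat.mul_lt_mul_of_pos_left hh hG⟩
  unfold InH at h1 ⊢; dsimp only at h1 ⊢
  simp only [e, k2]
  exact h1

/-! ## 2. The row (Z3, Z1) at p = 5 is empty at squarefree levels -/

/-- **THEOREM L, row p = 5: (Z3, Z1) DOES NOT OCCUR (squarefree odd `n`, `5 ∤ n`).**  At level `m = 5n`, a zero-sum triple
`T′ = (5y, x₂, x₃)` that is Z1 at 5 (`5 ∤ x₂`, `5 ∤ x₃`) with `5y ≢ 0 (mod m)` (`n ∤ y`) does not have the CM type of any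
triple `(5a, 5b, 5c)` with all entries divisible by 5 (`a, b, c` arbitrary).  [The alternative "x₁′ = ± m/3" of
`TheoremL.row_Z3Z1_five` is vacuous: pointwise at 5 (`RowUZ1Eleven.pointwise₅`), scaling by 5, DESCENT at level `5n`.] -/
theorem z3z1_five (n a b c y x₂ x₃ : ℕ) (hsq : Squarefree n) (h5n : ¬ 5 ∣ n) (hodd : Odd n)
    (hs : 5 * n ∣ 5 * y + x₂ + x₃) (hx₂ : ¬ 5 ∣ x₂) (hx₃ : ¬ 5 ∣ x₃) (hy : ¬ n ∣ y)
    (hH : SameType (5 * n) (5 * y, x₂, x₃) (5 * a, 5 * b, 5 * c)) : False := by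
  have hn : 0 < n := hodd.pos
  have h2 : ¬ 2 ∣ n := fun h => (Nat.not_even_iff_odd.mpr hodd) (even_iff_two_dvd.mpr h)
  -- step 1 (THEOREM L, row (Z3, Z1) at 5, generation 21): n = 3·gcd(y, n)
  obtain ⟨hg3, -⟩ := row_Z3Z1_five n a b c y x₂ x₃ h5n hn hodd hs hx₂ hx₃ hy (sameType_symm' hH)
  have hn3 : n = 3 * Nat.gcd y n := hg3.symm
  obtain ⟨g, hg⟩ : ∃ g, Nat.gcd y n = g := ⟨_, rfl⟩
  have hng : n = 3 * g := by rw [hn3, hg]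
  have h3 : 3 ∣ n := ⟨g, hng⟩
  have hn3g : n / 3 = g := by rw [hng, Nat.mul_div_cancel_left g (by norm_num)]
  -- step 2 (POINTWISE at 5, generation 29): H_{(a, b, c)} = H_V on the units of ℤ/n, V = (ȳ, ȳ, ȳ)
  have hV : SameType n (a, b, c) (y % n, y % n, y % n) := fun t₀ ht₀ => by
    rw [pointwise₅ h5n hn hn3 hs hx₂ hx₃ hH ht₀, inH_const hn hn3 ht₀]
  -- ȳ = (n/3)·w with w ∈ {1, 2} (LEMMA O)
  obtain ⟨w, hw, hyw⟩ : ∃ w, (w = 1 ∨ w = 2) ∧ y % n = n / 3 * w := by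
    rcases val_cases n y 1 hn hn3 (Nat.coprime_one_left n) with h | h <;> rw [one_mul, hg] at h
    · exact ⟨1, Or.inl rfl, by rw [h, hn3g, mul_one]⟩
    · exact ⟨2, Or.inr rfl, by rw [h, hn3g, mul_comm]⟩
  rw [hyw] at hV
  -- step 3 (SCALING by 5): (5a, 5b, 5c) — hence T′ — has the CM type of the constant triple (5n/3)(w, w, w) at level 5n
  have e5 : 5 * (n / 3 * w) = 5 * n / 3 * w := by rw [Nat.mul_div_assoc 5 h3, mul_assoc]
  have hT : SameType (5 * n) (5 * a, 5 * b, 5 * c) (5 * n / 3 * w, 5 * n / 3 * w, 5 * n / 3 * w) := by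
    rw [← e5]; exact sameType_scale (by norm_num) hV
  have hH' : SameType (5 * n) (5 * y, x₂, x₃) (5 * n / 3 * w, 5 * n / 3 * w, 5 * n / 3 * w) :=
    fun t ht => (hH t ht).trans (hT t ht)
  -- step 4 (DESCENT at the squarefree odd level 5n, 3 ∣ 5n): every entry of T′ is ≡ (5n/3)·w, so 5 ∣ x₂
  have hsq5 : Squarefree (5 * n) :=
    (Nat.squarefree_mul ((Nat.Prime.coprime_iff_not_dvd (by norm_num)).mpr h5n)).mpr
      ⟨(by norm_num : Nat.Prime 5).prime.squarefree, hsq⟩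
  have h2' : ¬ 2 ∣ 5 * n := fun h =>
    h2 (((Nat.Prime.dvd_mul Nat.prime_two).mp h).resolve_left (by norm_num))
  have h3' : 3 ∣ 5 * n := dvd_mul_of_dvd_right h3 5
  have hy' : ¬ 5 * n ∣ 5 * y := fun h => hy (Nat.dvd_of_mul_dvd_mul_left (by norm_num) h)
  have hx₂' : ¬ 5 * n ∣ x₂ := fun h => hx₂ ((dvd_mul_right 5 n).trans h)
  have hx₃' : ¬ 5 * n ∣ x₃ := fun h => hx₃ ((dvd_mul_right 5 n).trans h)
  obtain ⟨-, e₂, -⟩ := descent (5 * n) w (5 * y) x₂ x₃ hsq5 h2' h3' hw hs hy' hx₂' hx₃' hH'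
  exact hx₂ ((Nat.dvd_mod_iff (dvd_mul_right 5 n)).mp (by rw [e₂, ← e5]; exact dvd_mul_right 5 _))

/-- **THEOREM L, row p = 5: (Z3, Z1) does not occur** — the same statement with the Z3 triple written first (the
orientation of `TheoremL.row_Z3Z1_five`, whose conclusion "`3·gcd(y, n) = n` and `y ≡ ± n/3`" it supersedes at
squarefree levels: the premises are contradictory). -/
theorem z3z1_five' (n a b c y x₂ x₃ : ℕ) (hsq : Squarefree n) (h5n : ¬ 5 ∣ n) (hodd : Odd n)
    (hs : 5 * n ∣ 5 * y + x₂ + x₃) (hx₂ : ¬ 5 ∣ x₂) (hx₃ : ¬ 5 ∣ x₃) (hy : ¬ n ∣ y)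
    (hH : SameType (5 * n) (5 * a, 5 * b, 5 * c) (5 * y, x₂, x₃)) : False :=
  z3z1_five n a b c y x₂ x₃ hsq h5n hodd hs hx₂ hx₃ hy (sameType_symm' hH)

end HodgeFermat.KRFree.FiveZ3Z1
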